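import Literature.NumberTheory.DiophantineApproximation.PAdicNesterenkoCriterionBoxPrinciple
import HarnessLib

/-!
# The `p`-adic Nesterenko criterion over `ℚ` — the transference step (Chantanasiri 2012, Thm 2.4)

Topic `Literature/NumberTheory/DiophantineApproximation`. Everything in this file is PROVED; second of
three files discharging `Literature.NumberTheory.DiophantineApproximation.sprang2020_theorem14_rat`
(Sprang 2020, Thm 1.4, `K = ℚ`). Cell pub-zeta5 (HONEST FRAMING): a criterion made a theorem;
nothing here concerns `ζ(5)`.

`core` is Chantanasiri's ultrametric Théorème 2.4 [Chantanasiri2012, §2.2, pp. 95–99] in the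
`o(1)`-normalisation of [Sprang2020, Thm 1.4] and for a constant number `m + 1` of variables: for
`ξ₀ = 1, ξ₁, …, ξ_m ∈ ℤ_p` and integer forms `L_n = Σ_j l_{n,j} ξ_j` with
`|l_{n,j}| ≤ e^{(τ+o(1))σ(n)}`, `e^{−(τ₁+o(1))σ(n)} ≤ ‖L_n‖_p ≤ e^{−(τ₂−o(1))σ(n)}` (`σ(n) → ∞`,
`σ(n+1)/σ(n) → 1`, `τ > 0`, `τ₁ ≥ 0`) one has `τ₁/(τ + τ₁ − τ₂) ≤ m + 1`.

Proof (the printed one, pp. 98–99, with the unit normalisation of the box principle): suppose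
`τ₂ > mτ₁/(m+1) + τ`. The box principle `exists_unit_approx` gives a unit `a₀`, integers `a_t` with
`|a_t|^{m+1} ≤ p^{km}` and `‖a₀ξ_t − a_t‖_p ≤ p^{−k}`, `k` as large as we please. Take the LAST index
`n` with `‖L_n‖_p > p^{−k}` (it exists since `‖L_n‖_p → 0`). The integer `N = Σ_j l_{n,j} a_j`
satisfies `a₀L_n − N = Σ_j l_{n,j}(a₀ξ_j − a_j)`, of norm `≤ p^{−k} < ‖a₀ L_n‖_p`, so
`‖N‖_p = ‖L_n‖_p` [Chantanasiri2012, Lemme 2.7], `N ≠ 0`, and by the product formula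
`e^{(τ₂−o(1))σ(n)} ≤ 1/‖L_n‖_p ≤ |N| ≤ (m+1) · max_j|a_j| · e^{(τ+o(1))σ(n)}`, while
`p^k ≤ 1/‖L_{n+1}‖_p ≤ e^{(τ₁+o(1))σ(n+1)}` bounds `log max_j|a_j| ≤ (m/(m+1))(τ₁+o(1))σ(n+1)`;
with `σ(n+1)/σ(n) → 1` this contradicts `τ₂ > mτ₁/(m+1) + τ` for `k` (hence `n`) large. Together
with `τ₂ ≤ τ₁` (`tau_two_le_tau_one`) and `τ > 0` this is `τ₁ ≤ (m+1)(τ + τ₁ − τ₂)`.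

## References

* A. Chantanasiri, Ann. Math. Blaise Pascal 19 (2012) 75–105, §2.2 Théorème 2.4 and its proof
  pp. 98–99, Lemme 2.7. [Chantanasiri2012] (held: `paper:doi-10-5802-ambp-305`.)
* J. Sprang, Duke Math. J. 169 (2020), Thm 1.4 (statement, `o(1)`-form), §9. [Sprang2020]
-/

noncomputable section

open Filter Finset
open scoped Topology

namespace Literature.NumberTheory.DiophantineApproximation

namespace PAdicNesterenkoCriterion

variable {p : ℕ} [Fact p.Prime]

/-- From the two-sided bracket `e^{−(τ₁+o(1))σ(n)} ≤ ‖L_n‖_p ≤ e^{−(τ₂−o(1))σ(n)}` along `σ(n) → ∞`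
one always has `τ₂ ≤ τ₁`. [cite: Sprang2020, Thm 1.4 (hypotheses)] -/
theorem tau_two_le_tau_one {L : ℕ → ℚ_[p]} {τ₁ τ₂ : ℝ} {σ : ℕ → ℝ}
    (hσ : Tendsto σ atTop atTop)
    (H : ∀ ε : ℝ, 0 < ε → ∀ᶠ n in atTop,
      Real.exp (-(τ₁ + ε) * σ n) ≤ ‖L n‖ ∧ ‖L n‖ ≤ Real.exp (-(τ₂ - ε) * σ n)) :
    τ₂ ≤ τ₁ := by
  refine le_of_forall_pos_le_add fun ε hε => ?_
  have hε2 : 0 < ε / 2 := by linarith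
  obtain ⟨n, hn⟩ := ((H (ε / 2) hε2).and (hσ.eventually_gt_atTop 0)).exists
  obtain ⟨⟨h1, h2⟩, hσn⟩ := hn
  have h3 := Real.exp_le_exp.mp (h1.trans h2)
  have h4 : (τ₂ - ε / 2) * σ n ≤ (τ₁ + ε / 2) * σ n := by linarith
  have h5 := le_of_mul_le_mul_right h4 hσn
  linarith

/-- **Chantanasiri 2012, Théorème 2.4 (ultrametric Nesterenko criterion over `ℚ`), `o(1)`-form in
normalised coordinates.** Let `ξ₀ = 1, ξ₁, …, ξ_m ∈ ℤ_p` and let `L_n = Σ_j l_{n,j} ξ_j` be integer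
linear forms with, for every `ε > 0` and all large `n`, `|l_{n,j}| ≤ e^{(τ+ε)σ(n)}` and
`e^{−(τ₁+ε)σ(n)} ≤ ‖L_n‖_p ≤ e^{−(τ₂−ε)σ(n)}`, where `σ(n) → ∞`, `σ(n+1)/σ(n) → 1`, `τ > 0`,
`τ₁ ≥ 0`. Then `τ₁/(τ + τ₁ − τ₂) ≤ m + 1`. (Box principle at level `k`, last `n` with
`‖L_n‖_p > p^{−k}`, non-zero integer `N = Σ_j l_{n,j}a_j` with `‖N‖_p = ‖L_n‖_p`; see the module
docstring.) [cite: Chantanasiri2012, Thm 2.4 and its proof (pp. 98–99)] -/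
theorem core (m : ℕ) (ξ : Fin (m + 1) → ℚ_[p]) (hξ0 : ξ 0 = 1) (hξ : ∀ t, ‖ξ t‖ ≤ 1)
    (l : ℕ → Fin (m + 1) → ℤ) (L : ℕ → ℚ_[p]) (hL : ∀ n, L n = ∑ j, (l n j : ℚ_[p]) * ξ j)
    {τ₁ τ₂ τ : ℝ} (hτ₁ : 0 ≤ τ₁) (hτ : 0 < τ) {σ : ℕ → ℝ}
    (hσ : Tendsto σ atTop atTop) (hσ1 : Tendsto (fun n => σ (n + 1) / σ n) atTop (𝓝 1))
    (H : ∀ ε : ℝ, 0 < ε → ∀ᶠ n in atTop, (∀ j, (|l n j| : ℝ) ≤ Real.exp ((τ + ε) * σ n)) ∧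
        Real.exp (-(τ₁ + ε) * σ n) ≤ ‖L n‖ ∧ ‖L n‖ ≤ Real.exp (-(τ₂ - ε) * σ n)) :
    τ₁ / (τ + τ₁ - τ₂) ≤ (m + 1 : ℝ) := by
  classical
  have hp : p.Prime := Fact.out
  have hpR : (1 : ℝ) < p := by exact_mod_cast hp.one_lt
  have hpR0 : (0 : ℝ) < p := by positivity
  have h21 : τ₂ ≤ τ₁ := tau_two_le_tau_one hσ fun ε hε => (H ε hε).mono fun n hn => hn.2
  -- the main inequality `τ₂ ≤ m τ₁/(m+1) + τ`
  have hmR : (0 : ℝ) < (m : ℝ) + 1 := by positivity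
  set c : ℝ := (m : ℝ) / ((m : ℝ) + 1) with hc
  have hc0 : 0 ≤ c := by positivity
  have hc1 : c ≤ 1 := by rw [hc, div_le_one hmR]; linarith
  have hmain : τ₂ ≤ c * τ₁ + τ := by
    by_contra hcon
    rw [not_le] at hcon
    set η := τ₂ - (c * τ₁ + τ) with hη
    have hη0 : 0 < η := by linarith
    set ε := η / 4 with hε
    have hε0 : 0 < ε := by linarith
    have hε2 : ε < τ₂ := by
      have : η ≤ τ₂ - τ := by nlinarith
      linarith
    -- (E) eventually: `log(m+1) + (τ+ε)σ(n) + c(τ₁+ε)σ(n+1) < (τ₂-ε)σ(n)`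
    have hσpos : ∀ᶠ n in atTop, 0 < σ n := hσ.eventually_gt_atTop 0
    have hg : Tendsto (fun n => Real.log ((m : ℝ) + 1) / σ n + (τ + ε) +
        c * (τ₁ + ε) * (σ (n + 1) / σ n)) atTop (𝓝 (0 + (τ + ε) + c * (τ₁ + ε) * 1)) := by
      refine Tendsto.add (Tendsto.add ?_ tendsto_const_nhds) (hσ1.const_mul _)
      exact tendsto_const_nhds.div_atTop hσ
    have hlim : 0 + (τ + ε) + c * (τ₁ + ε) * 1 < τ₂ - ε := by
      have : c * ε ≤ ε := by nlinarith
      nlinarith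
    have hE : ∀ᶠ n in atTop, Real.log ((m : ℝ) + 1) + (τ + ε) * σ n +
        c * (τ₁ + ε) * σ (n + 1) < (τ₂ - ε) * σ n := by
      filter_upwards [(tendsto_order.1 hg).2 _ hlim, hσpos] with n hn hσn
      have hσn' : σ n ≠ 0 := hσn.ne'
      have h1 := mul_lt_mul_of_pos_right hn hσn
      have h2 : (Real.log ((m : ℝ) + 1) / σ n + (τ + ε) + c * (τ₁ + ε) * (σ (n + 1) / σ n)) * σ n
          = Real.log ((m : ℝ) + 1) + (τ + ε) * σ n + c * (τ₁ + ε) * σ (n + 1) := by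
        field_simp
      linarith
    -- collect everything beyond a threshold `N₀`
    have hH := H ε hε0
    have hH1 : ∀ᶠ n in atTop, (∀ j, (|l (n + 1) j| : ℝ) ≤ Real.exp ((τ + ε) * σ (n + 1))) ∧
        Real.exp (-(τ₁ + ε) * σ (n + 1)) ≤ ‖L (n + 1)‖ ∧
        ‖L (n + 1)‖ ≤ Real.exp (-(τ₂ - ε) * σ (n + 1)) := (tendsto_add_atTop_nat 1).eventually hH
    obtain ⟨N₀, hN₀⟩ := eventually_atTop.1 (((hH.and hH1).and hE).and hσpos)
    -- `‖L N₀‖ > 0`; choose the level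
    have hLN₀ : 0 < ‖L N₀‖ := lt_of_lt_of_le (Real.exp_pos _) (hN₀ N₀ le_rfl).1.1.1.2.1
    obtain ⟨j, hj⟩ := exists_pow_lt_of_lt_one hLN₀ (by
      rw [one_div]; exact inv_lt_one_of_one_lt₀ hpR : 1 / (p : ℝ) < 1)
    have hj' : (p : ℝ) ^ (-((j + 1 : ℕ) : ℤ)) < ‖L N₀‖ := by
      refine lt_of_le_of_lt ?_ hj
      rw [zpow_neg, zpow_natCast, one_div, ← inv_pow]
      exact pow_le_pow_of_le_one (by positivity) (inv_le_one_of_one_le₀ hpR.le) (Nat.le_succ j)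
    obtain ⟨k, a, hjk, ha0, hsize, hcong⟩ := exists_unit_approx m ξ hξ0 hξ (j := j + 1) (by omega)
    have hpk : (p : ℝ) ^ (-(k : ℤ)) < ‖L N₀‖ :=
      lt_of_le_of_lt (zpow_le_zpow_right₀ hpR.le (by omega)) hj'
    -- the last index `n ≥ N₀` with `‖L n‖ > p^{-k}`
    have hex : ∃ i, ‖L (N₀ + i + 1)‖ ≤ (p : ℝ) ^ (-(k : ℤ)) := by
      have ht : Tendsto (fun n => Real.exp (-(τ₂ - ε) * σ n)) atTop (𝓝 0) := by
        have h1 : Tendsto (fun n => (τ₂ - ε) * σ n) atTop atTop :=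
          hσ.const_mul_atTop (by linarith)
        have h2 := Real.tendsto_exp_neg_atTop_nhds_zero.comp h1
        refine h2.congr fun n => ?_
        simp only [Function.comp, neg_mul]
      obtain ⟨N₂, hN₂⟩ := eventually_atTop.1 ((tendsto_order.1 ht).2 _ (by positivity :
        (0 : ℝ) < (p : ℝ) ^ (-(k : ℤ))))
      refine ⟨N₂, ?_⟩
      have h3 := (hN₀ (N₀ + N₂ + 1) (by omega)).1.1.1.2.2
      exact h3.trans (hN₂ _ (by omega)).le
    set i₀ := Nat.find hex with hi₀
    set n := N₀ + i₀ with hn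
    have hn1 : ‖L (n + 1)‖ ≤ (p : ℝ) ^ (-(k : ℤ)) := Nat.find_spec hex
    have hn0 : (p : ℝ) ^ (-(k : ℤ)) < ‖L n‖ := by
      rcases Nat.eq_zero_or_eq_succ_pred i₀ with h | h
      · rw [hn, h, add_zero]; exact hpk
      · have h2 := Nat.find_min hex (show i₀ - 1 < i₀ by omega)
        rw [not_le] at h2
        have h3 : N₀ + (i₀ - 1) + 1 = n := by omega
        rwa [h3] at h2
    have hnN : N₀ ≤ n := by omega
    obtain ⟨⟨⟨⟨hl, -, hup⟩, ⟨-, hlo1, -⟩⟩, hEn⟩, hσn⟩ := hN₀ n hnN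
    -- the integer `N`
    set N : ℤ := ∑ j, l n j * a j with hN
    have hEsum : (a 0 : ℚ_[p]) * L n - N = ∑ j, (l n j : ℚ_[p]) * ((a 0 : ℚ_[p]) * ξ j - a j) := by
      rw [hL n, hN, Finset.mul_sum, Int.cast_sum, ← Finset.sum_sub_distrib]
      refine Finset.sum_congr rfl fun j _ => ?_
      push_cast; ring
    have hEnorm : ‖∑ j, (l n j : ℚ_[p]) * ((a 0 : ℚ_[p]) * ξ j - a j)‖ ≤ (p : ℝ) ^ (-(k : ℤ)) := by
      refine IsUltrametricDist.norm_sum_le_of_forall_le_of_nonneg (by positivity) fun j _ => ?_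
      rw [norm_mul]
      calc ‖(l n j : ℚ_[p])‖ * ‖(a 0 : ℚ_[p]) * ξ j - a j‖ ≤ 1 * (p : ℝ) ^ (-(k : ℤ)) :=
            mul_le_mul (Padic.norm_int_le_one _) (hcong j) (norm_nonneg _) zero_le_one
        _ = _ := one_mul _
    have hNnorm : ‖(N : ℚ_[p])‖ = ‖L n‖ := by
      have h1 : ‖(a 0 : ℚ_[p]) * L n‖ = ‖L n‖ := by rw [norm_mul, ha0, one_mul]
      have h2 : (N : ℚ_[p]) = (a 0 : ℚ_[p]) * L n +
          -(∑ j, (l n j : ℚ_[p]) * ((a 0 : ℚ_[p]) * ξ j - a j)) := by rw [← hEsum]; ring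
      have h3 : ‖-(∑ j, (l n j : ℚ_[p]) * ((a 0 : ℚ_[p]) * ξ j - a j))‖ < ‖(a 0 : ℚ_[p]) * L n‖ := by
        rw [norm_neg, h1]; exact hEnorm.trans_lt hn0
      rw [h2, Padic.add_eq_max_of_ne h3.ne', max_eq_left h3.le, h1]
    have hN0 : N ≠ 0 := by
      intro h
      have : ‖(N : ℚ_[p])‖ = 0 := by rw [h, Int.cast_zero, norm_zero]
      rw [hNnorm] at this
      linarith [(show (0:ℝ) < (p : ℝ) ^ (-(k : ℤ)) by positivity)]
    -- lower bound for `|N|`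
    have hlow : Real.exp ((τ₂ - ε) * σ n) ≤ |(N : ℝ)| := by
      have h1 := one_le_abs_mul_padicNorm (p := p) hN0
      rw [hNnorm] at h1
      have h2 : |(N : ℝ)| * ‖L n‖ ≤ |(N : ℝ)| * Real.exp (-(τ₂ - ε) * σ n) :=
        mul_le_mul_of_nonneg_left hup (abs_nonneg _)
      have h3 : Real.exp ((τ₂ - ε) * σ n) * Real.exp (-(τ₂ - ε) * σ n) = 1 := by
        rw [← Real.exp_add, neg_mul, add_neg_cancel, Real.exp_zero]
      nlinarith [Real.exp_pos ((τ₂ - ε) * σ n), Real.exp_pos (-(τ₂ - ε) * σ n)]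
    -- upper bound for `|N|`
    obtain ⟨jm, -, hjm⟩ := Finset.exists_max_image Finset.univ (fun j => |a j|) Finset.univ_nonempty
    set A : ℝ := ((|a jm| : ℤ) : ℝ) with hA
    have ha00 : a 0 ≠ 0 := by
      intro h; rw [h, Int.cast_zero, norm_zero] at ha0; exact zero_ne_one ha0
    have hA1 : 1 ≤ A := by
      rw [hA]
      have : (1 : ℤ) ≤ |a jm| := (Int.one_le_abs ha00).trans (hjm 0 (Finset.mem_univ _))
      exact_mod_cast this
    have hA0 : 0 < A := by linarith
    have hupN : |(N : ℝ)| ≤ ((m : ℝ) + 1) * (Real.exp ((τ + ε) * σ n) * A) := by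
      rw [hN, Int.cast_sum]
      refine (Finset.abs_sum_le_sum_abs _ _).trans ?_
      have h1 : ∀ j ∈ Finset.univ, |((l n j * a j : ℤ) : ℝ)| ≤ Real.exp ((τ + ε) * σ n) * A := by
        intro j _
        push_cast
        rw [abs_mul]
        refine mul_le_mul (hl j) ?_ (abs_nonneg _) (Real.exp_pos _).le
        rw [hA]; exact_mod_cast hjm j (Finset.mem_univ _)
      refine (Finset.sum_le_sum h1).trans ?_
      rw [Finset.sum_const, Finset.card_univ, Fintype.card_fin, nsmul_eq_mul]
      push_cast
      exact le_rfl
    -- `log A ≤ c (τ₁+ε) σ(n+1)` from `A^{m+1} ≤ p^{km}` and `p^k ≤ 1/‖L(n+1)‖ ≤ e^{(τ₁+ε)σ(n+1)}`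
    have hlogp : 0 < Real.log p := Real.log_pos hpR
    have hk : (k : ℝ) * Real.log p ≤ (τ₁ + ε) * σ (n + 1) := by
      have h1 := hlo1.trans hn1
      have h2 : (p : ℝ) ^ (-(k : ℤ)) = Real.exp (-((k : ℝ) * Real.log p)) := by
        rw [zpow_neg, zpow_natCast, Real.exp_neg, ← Real.log_pow, Real.exp_log (by positivity)]
      rw [h2, Real.exp_le_exp] at h1
      linarith
    have hlogA : Real.log A ≤ c * ((τ₁ + ε) * σ (n + 1)) := by
      have h1 : A ^ (m + 1) ≤ (p : ℝ) ^ (k * m) := by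
        rw [hA]; exact_mod_cast hsize jm
      have h2 := Real.log_le_log (by positivity) h1
      rw [Real.log_pow, Real.log_pow] at h2
      push_cast at h2
      rw [hc, div_mul_eq_mul_div, le_div_iff₀ hmR]
      nlinarith
    -- the contradiction
    have hfin : (τ₂ - ε) * σ n ≤ Real.log ((m : ℝ) + 1) + (τ + ε) * σ n + c * (τ₁ + ε) * σ (n + 1) := by
      have h1 := Real.log_le_log (Real.exp_pos _) (hlow.trans hupN)
      rw [Real.log_exp, Real.log_mul hmR.ne' (by positivity), Real.log_mul (Real.exp_pos _).ne'
        hA0.ne', Real.log_exp] at h1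
      linarith
    linarith
  -- final algebra
  have hD : 0 < τ + τ₁ - τ₂ := by linarith
  rw [div_le_iff₀ hD]
  have h1 : ((m : ℝ) + 1) * (c * τ₁) = m * τ₁ := by rw [hc]; field_simp
  nlinarith

end PAdicNesterenkoCriterion

end Literature.NumberTheory.DiophantineApproximation
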